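import Summits.HodgeConjecture.CorCM.IrreducibleOddWeightsHodgeGluingIntrinsic
import Summits.HodgeConjecture.CorCM.IrreducibleOddWeightsProductSpanBlocks
import HarnessLib

/-!
# The `n`-ary Moonen–Zarhin equivalence, INTRINSIC FORM: for complex abelian varieties `X_1, …, X_n` of CM type,
# `Hg(∏_j X_j) = ∏_j Hg(X_j)` IFF the Hodge classes of `(∏_k X_{π₁ k}) × (∏_k X_{π₂ k})` are exterior products for all
# products of copies taken from DISJOINT sets of factors

COR-CM (cell `pub-hodgecm2`, binder seat `b16` gen 60, count-neutral claim HODGE GLUING, file G9 — complex abelian varieties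
of CM type, NO CM data in the statements; theorems only, no definition, no named fact, no `sorry`).  NEW as stated,
hence under `Summits/`.  HONEST FRAMING: an unconditional structure theorem on Hodge classes of products of abelian
varieties of CM type; `HC_CM` is neither used nor asserted.

Moonen–Zarhin 1999 §3 (3.1): for TWO abelian varieties, `Hg(X × Y) = Hg(X) × Hg(Y)` iff the Hodge classes of every
`X^k × Y^l` are products of Hodge classes of the factors (kernel form for CM type:
`Pohlmann1968/HodgeClassesProductSpanCMProductsPowersIntrinsic`).  Here `n` factors `X : Fin n → AbelianVariety ℂ` of CM
type and positive dimension, the condition `Hg(∏_j X_j) = ∏_j Hg(X_j)` being written as the Mumford–Tate rank identity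
`dim MT(H¹(⨁ X)) + n = Σ_j dim MT(H¹(X j)) + 1` (`MT = 𝔾_m · Hg`):

* **`hodgeClassesProductSpan_biproduct_of_mtRank_add_card_eq`** (⟹): for slot maps `π₁ : J₁ → Fin n`, `π₂ : J₂ → Fin n`
  with disjoint images, every rational Hodge class on `(⨁_k X (π₁ k)) × (⨁_k X (π₂ k))` is a `ℂ`-combination of
  exterior products of rational Hodge classes of the two factors.
* **`exists_not_hodgeClassesProductSpan_of_mtRank_add_card_ne`** (⟸, contrapositive): if the identity fails, some
  `X_{c₀}^{a} × ∏_k X_{π₂ k}` (`π₂` avoiding `c₀`) carries a rational Hodge class outside the span of exterior products.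
* **`mtRank_add_card_eq_iff_forall_hodgeClassesProductSpan`** — THE EQUIVALENCE.
Method: Milne's regrouping of each `X j` into CM realisations (as in G6), under which the rank identity is BLOCK
additivity of the glued family, and the block equivalence of G8
(`cmFamilyRank_fiber_add_card_eq_iff_forall_hodgeClassesProductSpan`); products of copies of the `X j` are isogenous to
products of copies of their constituents, and products of copies of constituents are retracts of those.

## References

* [MoonenZarhin1999LowDim] B. Moonen, Yu. Zarhin, *Hodge classes on abelian varieties of low dimension*, Math. Ann.
  315 (1999), §2 and §3 (3.1).
* [Deligne1982HodgeCycles] P. Deligne, *Hodge cycles on abelian varieties*, LNM 900 (1982), I Ex. 3.7 (c).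
* [Milne1999LefschetzClasses] J. S. Milne, *Lefschetz classes on abelian varieties*, Duke Math. J. 96 (1999), §1.
* [Gordon1999HodgeAVSurvey] B. B. Gordon, *A survey of the Hodge conjecture for abelian varieties*, 7.5–7.7.
* [MumfordAV1970] D. Mumford, *Abelian Varieties* (1970), §19.
-/

set_option autoImplicit false

noncomputable section

open scoped BigOperators

open CategoryTheory CategoryTheory.Limits NumberField

namespace Summit.HodgeConjecture.CorCM

open Literature.NumberTheory.ComplexMultiplication
open Literature.AlgebraicGeometry.Motives
open Literature.AlgebraicGeometry.Motives.AbelianVariety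
open Literature.AlgebraicGeometry.HodgeTheory
open Literature.AlgebraicGeometry.ComplexMultiplication (IsCMTypeRealisation)
open Literature.AlgebraicGeometry.Milne1999 (IsOfCMType exists_isIsogeny_to_biproduct_of_classes_of_isOfCMType)
open Literature.AlgebraicGeometry.Pohlmann1968

/-! ### §1 Products of copies of constituents are retracts (product-span form) -/

section Bookkeeping

/-- **The product-span property descends to products of copies of constituents**: for `B_{j,i}` and choices
`φ_r`, `ψ_r` (`r = 1, 2`), `HodgeClassesProductSpan (⨁_k ⨁_i B_{φ₁ k, i}) (⨁_k ⨁_i B_{φ₂ k, i})` implies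
`HodgeClassesProductSpan (⨁_k B_{φ₁ k, ψ₁ k}) (⨁_k B_{φ₂ k, ψ₂ k})` (both are retracts: slot in, projection out).
[cite: MumfordAV1970, §19] [cite: MoonenZarhin1999LowDim, §3 (3.1)] -/
theorem hodgeClassesProductSpan_biproduct_apply_of_biproduct_biproduct {ι₀ : Type} {D : ι₀ → Type}
    [∀ j, Fintype (D j)] (B : ∀ j, D j → AbelianVariety ℂ) {J₁ J₂ : Type} [Fintype J₁] [Fintype J₂]
    (φ₁ : J₁ → ι₀) (ψ₁ : ∀ k, D (φ₁ k)) (φ₂ : J₂ → ι₀) (ψ₂ : ∀ k, D (φ₂ k))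
    (h : HodgeClassesProductSpan (⨁ fun k => ⨁ B (φ₁ k)) (⨁ fun k => ⨁ B (φ₂ k))) :
    HodgeClassesProductSpan (⨁ fun k => B (φ₁ k) (ψ₁ k)) (⨁ fun k => B (φ₂ k) (ψ₂ k)) := by
  classical
  have hret : ∀ {J : Type} [Fintype J] (φ : J → ι₀) (ψ : ∀ k, D (φ k)),
      (biproduct.map fun k => biproduct.ι (B (φ k)) (ψ k)) ≫ (biproduct.map fun k => biproduct.π (B (φ k)) (ψ k)) =
        (1 : ℕ) • 𝟙 (⨁ fun k => B (φ k) (ψ k)) := by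
    intro J _ φ ψ
    rw [one_smul]
    refine biproduct.hom_ext _ _ fun k => ?_
    rw [Category.assoc, biproduct.map_π, ← Category.assoc, biproduct.map_π, Category.assoc, biproduct.ι_π_self,
      Category.comp_id, Category.id_comp]
  exact h.of_comp_eq_nsmul_id _ _ one_ne_zero (hret φ₁ ψ₁) _ _ one_ne_zero (hret φ₂ ψ₂)

end Bookkeeping

/-! ### §2 The intrinsic equivalence -/

section Intrinsic

variable [HodgeTensorFacts.{0, 0}]

/-- **THE `n`-ARY MOONEN–ZARHIN EQUIVALENCE FOR ABELIAN VARIETIES OF CM TYPE.**  `X : Fin n → AbelianVariety ℂ`, each of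
CM type and positive dimension; `t(Y) = dim MT(H¹(Y, ℚ))` (the tree's `mtRank`, any smooth-projective witnesses).  Then
`t(⨁ X) + n = Σ_j t(X j) + 1` — i.e. `Hg(∏_j X_j) = ∏_j Hg(X_j)` — IF AND ONLY IF for all `N₁, N₂ ≥ 1` and all
`π₁ : Fin N₁ → Fin n`, `π₂ : Fin N₂ → Fin n` with disjoint images, every rational Hodge class on
`(⨁_k X (π₁ k)) × (⨁_k X (π₂ k))` is a `ℂ`-combination of exterior products of rational Hodge classes of the two factors.
[cite: MoonenZarhin1999LowDim, §2 and §3 (3.1)] [cite: Deligne1982HodgeCycles, I Ex. 3.7 (c)]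
[cite: Milne1999LefschetzClasses, §1 Prop. 1.1 (p. 643)] [cite: Gordon1999HodgeAVSurvey, 7.5–7.7] -/
theorem mtRank_add_card_eq_iff_forall_hodgeClassesProductSpan {n : ℕ} (X : Fin n → AbelianVariety ℂ)
    (hX0 : ∀ j, 0 < (X j).dim) (hcm : ∀ j, IsOfCMType (X j)) {kX : Fin n → ℕ}
    (hX : ∀ j, IsSmoothProjective (kX j) (X j).X) {kP : ℕ} (hP : IsSmoothProjective kP (⨁ X).X) [NeZero n] :
    (   haveI := BettiUniverse.finite hP 1
        haveI := fun j => BettiUniverse.finite (hX j) 1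
      (BettiUniverse.hodge exists_isReal_hodgeModel_holds hP 1).mtRank + n =
        (∑ j, (BettiUniverse.hodge exists_isReal_hodgeModel_holds (hX j) 1).mtRank) + 1) ↔
    ∀ (N₁ N₂ : ℕ) [NeZero N₁] [NeZero N₂] (π₁ : Fin N₁ → Fin n) (π₂ : Fin N₂ → Fin n), (∀ k₁ k₂, π₁ k₁ ≠ π₂ k₂) →
      HodgeClassesProductSpan (⨁ fun k => X (π₁ k)) (⨁ fun k => X (π₂ k)) := by
  classical
  -- Milne's regrouping of every factor, and the glued family `(j, i) ↦ A j (cls j i)` (as in G6)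
  choose C instC K instF instNF instCM Φ A ι θ m cls f hA _h1 _h2 hf using
    fun j => exists_isIsogeny_to_biproduct_of_classes_of_isOfCMType (hX0 j) (hcm j)
  let I' : Type := Σ j : Fin n, Fin (m j + 1)
  let K' : I' → Type := fun x => K x.1 (cls x.1 x.2)
  letI : ∀ x : I', Field (K' x) := fun x => instF x.1 (cls x.1 x.2)
  letI : ∀ x : I', NumberField (K' x) := fun x => instNF x.1 (cls x.1 x.2)
  haveI : ∀ x : I', IsCMField (K' x) := fun x => instCM x.1 (cls x.1 x.2)
  let Φ' : ∀ x : I', CMType (K' x) := fun x => Φ x.1 (cls x.1 x.2)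
  let A' : I' → AbelianVariety ℂ := fun x => A x.1 (cls x.1 x.2)
  have hA' : ∀ x : I', IsCMTypeRealisation (Φ' x) (A' x) (ι x.1 (cls x.1 x.2)) (θ x.1 (cls x.1 x.2)) :=
    fun x => hA x.1 (cls x.1 x.2)
  have hκ : Function.Surjective (fun x : I' => x.1) := fun j => ⟨⟨j, 0⟩, rfl⟩
  haveI : Nonempty I' := ⟨⟨0, 0⟩⟩
  have hXj : ∀ j, IsIsogenous (X j) (⨁ fun i : Fin (m j + 1) => A j (cls j i)) := fun j => ⟨f j, hf j⟩
  have hPB : IsIsogenous (⨁ X) (⨁ fun x : I' => A' x) :=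
    (IsIsogenous.biproduct hXj).trans (isIsogenous_biproduct_biproduct_sigma fun j i => A j (cls j i))
  -- the rank identity is block additivity of the glued family
  have hrankP : haveI := BettiUniverse.finite hP 1
      (BettiUniverse.hodge exists_isReal_hodgeModel_holds hP 1).mtRank = CMAlgebra.cmFamilyRank Φ' :=
    mtRank_hodge_one_eq_cmFamilyRank_of_isIsogenous_biproduct (cls := fun x : I' => x) hA'
      Function.surjective_id hP hPB
  have hrankX : ∀ j, haveI := BettiUniverse.finite (hX j) 1
      (BettiUniverse.hodge exists_isReal_hodgeModel_holds (hX j) 1).mtRank =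
        CMAlgebra.cmFamilyRank fun i : Fin (m j + 1) => Φ j (cls j i) := fun j =>
    mtRank_hodge_one_eq_cmFamilyRank_of_isIsogenous_biproduct (cls := fun i : Fin (m j + 1) => i)
      (fun i => hA j (cls j i)) Function.surjective_id (hX j) (hXj j)
  have hblock : ∀ j, CMAlgebra.cmFamilyRank (fun x : {x : I' // x.1 = j} => Φ' x.1) =
      CMAlgebra.cmFamilyRank fun i : Fin (m j + 1) => Φ j (cls j i) := by
    intro j
    have hsurj : Function.Surjective fun i : Fin (m j + 1) => (⟨⟨j, i⟩, rfl⟩ : {x : I' // x.1 = j}) := by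
      rintro ⟨⟨j', i⟩, h⟩
      change j' = j at h
      subst h
      exact ⟨i, rfl⟩
    exact (CMAlgebra.cmFamilyRank_comp_of_surjective (fun x : {x : I' // x.1 = j} => Φ' x.1) hsurj).symm
  have hiff : (   haveI := BettiUniverse.finite hP 1
                  haveI := fun j => BettiUniverse.finite (hX j) 1
      (BettiUniverse.hodge exists_isReal_hodgeModel_holds hP 1).mtRank + n =
        (∑ j, (BettiUniverse.hodge exists_isReal_hodgeModel_holds (hX j) 1).mtRank) + 1) ↔
      CMAlgebra.cmFamilyRank Φ' + Fintype.card (Fin n) =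
        (∑ j, CMAlgebra.cmFamilyRank fun x : {x : I' // x.1 = j} => Φ' x.1) + 1 := by
    rw [Fintype.card_fin, ← hrankP, Finset.sum_congr rfl fun j _ => (hblock j).trans (hrankX j).symm]
  rw [hiff, cmFamilyRank_fiber_add_card_eq_iff_forall_hodgeClassesProductSpan (Φ := Φ') (A := A')
    (fun x : I' => x.1) hκ hA']
  -- products of copies of the `X j` versus products of copies of the constituents
  constructor
  · intro h N₁ N₂ _ _ π₁ π₂ hdisj
    haveI : Nonempty (Σ k : Fin N₁, Fin (m (π₁ k) + 1)) := ⟨⟨0, 0⟩⟩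
    haveI : Nonempty (Σ k : Fin N₂, Fin (m (π₂ k) + 1)) := ⟨⟨0, 0⟩⟩
    have hσ := h (Fintype.card (Σ k : Fin N₁, Fin (m (π₁ k) + 1))) (Fintype.card (Σ k : Fin N₂, Fin (m (π₂ k) + 1)))
      (fun y => (⟨π₁ ((Fintype.equivFin _).symm y).1, ((Fintype.equivFin _).symm y).2⟩ : I'))
      (fun y => (⟨π₂ ((Fintype.equivFin _).symm y).1, ((Fintype.equivFin _).symm y).2⟩ : I'))
      fun y₁ y₂ => hdisj _ _
    -- `⨁_k X (π_r k) ∼ ⨁_k ⨁_i A (π_r k) (cls _ i) ≅ ⨁_{(k,i)} A' ⟨π_r k, i⟩ ≅` its enumeration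
    have iso : ∀ {N : ℕ} (π : Fin N → Fin n), IsIsogenous (⨁ fun k => X (π k))
        (⨁ fun y : Fin (Fintype.card (Σ k : Fin N, Fin (m (π k) + 1))) =>
          A' ⟨π ((Fintype.equivFin _).symm y).1, ((Fintype.equivFin _).symm y).2⟩) := by
      intro N π
      refine ((IsIsogenous.biproduct fun k => hXj (π k)).trans
        (isIsogenous_biproduct_biproduct_sigma fun k i => A (π k) (cls (π k) i))).trans ?_
      exact ⟨(biproduct.reindex (Fintype.equivFin (Σ k : Fin N, Fin (m (π k) + 1))).symm
          fun y : Σ k : Fin N, Fin (m (π k) + 1) => A (π y.1) (cls (π y.1) y.2)).inv,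
        isIsogeny_hom_of_iso (biproduct.reindex (Fintype.equivFin (Σ k : Fin N, Fin (m (π k) + 1))).symm
          fun y : Σ k : Fin N, Fin (m (π k) + 1) => A (π y.1) (cls (π y.1) y.2)).symm⟩
    exact hσ.of_isIsogenous (iso π₁) (iso π₂)
  · intro h N₁ N₂ _ _ σ₁ σ₂ hdisj
    -- the products of copies of the blocks `X (σ_r j).1` have the product-span property by hypothesis …
    have hX' := h N₁ N₂ (fun j => (σ₁ j).1) (fun j => (σ₂ j).1) hdisj
    -- … hence the products of the full constituent lists (isogenous) …
    have hfull : HodgeClassesProductSpan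
        (⨁ fun j => ⨁ fun i : Fin (m (σ₁ j).1 + 1) => A (σ₁ j).1 (cls (σ₁ j).1 i))
        (⨁ fun j => ⨁ fun i : Fin (m (σ₂ j).1 + 1) => A (σ₂ j).1 (cls (σ₂ j).1 i)) :=
      hX'.of_isIsogenous' (IsIsogenous.biproduct fun j => hXj (σ₁ j).1) (IsIsogenous.biproduct fun j => hXj (σ₂ j).1)
    -- … hence their retracts `⨁_j A' (σ_r j)`
    exact hodgeClassesProductSpan_biproduct_apply_of_biproduct_biproduct (fun j i => A j (cls j i))
      (fun j => (σ₁ j).1) (fun j => (σ₁ j).2) (fun j => (σ₂ j).1) (fun j => (σ₂ j).2) hfull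

/-- **`Hg(∏_j X_j) = ∏_j Hg(X_j)` ⟹ exterior products span**, intrinsic form: under the Mumford–Tate rank identity, for
all slot maps `π₁ : Fin N₁ → Fin n`, `π₂ : Fin N₂ → Fin n` with disjoint images,
`HodgeClassesProductSpan (⨁_k X (π₁ k)) (⨁_k X (π₂ k))` — e.g. for `∏_{j ∈ S} X_j^{a_j} × ∏_{j ∉ S} X_j^{b_j}`.
[cite: MoonenZarhin1999LowDim, §3 (3.1)] [cite: Gordon1999HodgeAVSurvey, 7.5–7.7] -/
theorem hodgeClassesProductSpan_biproduct_of_mtRank_add_card_eq {n : ℕ} (X : Fin n → AbelianVariety ℂ)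
    (hX0 : ∀ j, 0 < (X j).dim) (hcm : ∀ j, IsOfCMType (X j)) {kX : Fin n → ℕ}
    (hX : ∀ j, IsSmoothProjective (kX j) (X j).X) {kP : ℕ} (hP : IsSmoothProjective kP (⨁ X).X)
    (hadd : haveI := BettiUniverse.finite hP 1
      haveI := fun j => BettiUniverse.finite (hX j) 1
      (BettiUniverse.hodge exists_isReal_hodgeModel_holds hP 1).mtRank + n =
        (∑ j, (BettiUniverse.hodge exists_isReal_hodgeModel_holds (hX j) 1).mtRank) + 1)
    {N₁ N₂ : ℕ} [NeZero N₁] [NeZero N₂] (π₁ : Fin N₁ → Fin n) (π₂ : Fin N₂ → Fin n)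
    (hdisj : ∀ k₁ k₂, π₁ k₁ ≠ π₂ k₂) :
    HodgeClassesProductSpan (⨁ fun k => X (π₁ k)) (⨁ fun k => X (π₂ k)) := by
  haveI : NeZero n := ⟨fun h => by subst h; exact Fin.elim0 (π₁ 0)⟩
  exact (mtRank_add_card_eq_iff_forall_hodgeClassesProductSpan X hX0 hcm hX hP).1 hadd N₁ N₂ π₁ π₂ hdisj

/-- **`Hg(∏_j X_j) ⊊ ∏_j Hg(X_j)` ⟹ an exceptional mixed class on a product of copies from disjoint sets of factors**,
intrinsic form: if the Mumford–Tate rank identity FAILS then for some `π₁`, `π₂` with disjoint images,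
`(⨁_k X (π₁ k)) × (⨁_k X (π₂ k))` carries a rational Hodge class that is not a `ℂ`-combination of exterior products of
Hodge classes of the two factors. [cite: MoonenZarhin1999LowDim, §3 (3.1)] [cite: Gordon1999HodgeAVSurvey, 7.5 (1) ⟹ (3)] -/
theorem exists_not_hodgeClassesProductSpan_of_mtRank_add_card_ne {n : ℕ} [NeZero n] (X : Fin n → AbelianVariety ℂ)
    (hX0 : ∀ j, 0 < (X j).dim) (hcm : ∀ j, IsOfCMType (X j)) {kX : Fin n → ℕ}
    (hX : ∀ j, IsSmoothProjective (kX j) (X j).X) {kP : ℕ} (hP : IsSmoothProjective kP (⨁ X).X)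
    (hne : haveI := BettiUniverse.finite hP 1
      haveI := fun j => BettiUniverse.finite (hX j) 1
      (BettiUniverse.hodge exists_isReal_hodgeModel_holds hP 1).mtRank + n ≠
        (∑ j, (BettiUniverse.hodge exists_isReal_hodgeModel_holds (hX j) 1).mtRank) + 1) :
    ∃ (N₁ N₂ : ℕ) (_ : NeZero N₁) (_ : NeZero N₂) (π₁ : Fin N₁ → Fin n) (π₂ : Fin N₂ → Fin n),
      (∀ k₁ k₂, π₁ k₁ ≠ π₂ k₂) ∧ ¬ HodgeClassesProductSpan (⨁ fun k => X (π₁ k)) (⨁ fun k => X (π₂ k)) := by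
  by_contra hall
  push Not at hall
  exact hne ((mtRank_add_card_eq_iff_forall_hodgeClassesProductSpan X hX0 hcm hX hP).2
    fun N₁ N₂ _ _ π₁ π₂ hdisj => hall N₁ N₂ inferInstance inferInstance π₁ π₂ hdisj)

end Intrinsic

end Summit.HodgeConjecture.CorCM

end
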